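import Summits.QuantumAdvantage.QuantumAdvantage.Theorems.CubicForrelationNearExactIsExactCubicFormFibreMenu
import Summits.QuantumAdvantage.QuantumAdvantage.Theorems.CubicForrelationNearExactIsExactCubicFormFibreTypes
import Summits.QuantumAdvantage.QuantumAdvantage.Theorems.CubicForrelationNearExactIsExactCubicFormFibreH1

/-!
# Crux `CubicForrelation.NearExactIsExact` (stmt-QuantumAdvantage-14043) — CELL LEMMA L-T assembled: the TYPES of a light cell with
  cubic form `T = y₀y₁y₂`

Certificate seat `b2b-cforr-cert` (gen 41).  HONEST FRAMING: kernel-checked assembly (standard axioms) of the fibre files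
…CubicFormFibre (fibre formula), …FibreMenu (`h ≥ 2 ⇒ wt ≥ 192`), …FibreAffine/…FibreTypes (`h = 0`: menu and rank of `β_UF`),
…FibreH1 (`h = 1`: `wt ≥ 160`, type `(1,0)`), with the frame supplied by …CubicFormSymplectic.  INPUT: only `f` on `3 + 6` bits and the
hypothesis that its cubic form is that of `y₀y₁y₂` (`hT`).  OUTPUT, with `Q := f ⊕ y₀y₁y₂`, `Q_t := Q(t, ·)`, `B :=` the second derivative
of `Q_0`, `β_UF(a, x) := Q(a,x) ⊕ Q(a,0) ⊕ Q(0,x) ⊕ Q(0,0)`: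
  `64 ≤ wt f`;  `wt f < 128 ⇒ B = 0, β_UF = 0` (type `(0,0)`: the alternating part lies in `Λ²U*`);
  `wt f < 160 ⇒ B = 0` (all fibres affine) and the rows `β_UF(a, ·)` lie in `{0, m}` (types `(0,0)`, `(0,1)`);
  `wt f < 192 ⇒` the same, OR `B` has a maximal frame of size one `(b₀, c₀)` and every `Q_t` is constant on `Rad B` (type `(1,0)`).
This is cell lemma L-T of HOME/b2b-cforr-cert-g39/E1280-HANDPROOFS.md App. A.3 ("CONSEQUENCES USED IN §1") as one theorem.
Nothing about `θ₁₂`; NOT summit progress.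

* `tlt_second_const`: the second derivative of `Q_t` is `B`, for every fibre `t` and base point.
* `tlt_T_cell_types`: the statement above.

References: E1280-HANDPROOFS.md App. A.3.  Axioms: the standard three.
-/

set_option linter.dupNamespace false -- D-0017: single-problem summit ⇒ `QuantumAdvantage.QuantumAdvantage` by design

namespace Summit.QuantumAdvantage.QuantumAdvantage.Theorems.CubicForrelation.NearExactIsExact

open Finset
open Literature.Computability.QuantumComplexity.BuzetChailloux (bxor zeroVec allOnes bxor_comm bxor_self bxor_zeroVec zeroVec_bxor
  bxor_bxor_cancel_left)

/-- **The fibre quadratics share one symplectic form.**  If `f` on `3 + 6` bits has the cubic form of `y₀y₁y₂`, then for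
`Q := f ⊕ y₀y₁y₂` the second derivative `Δ_{v,w} Q(t, ·)(x)` is independent of the fibre `t` and the base point `x`. [this work] -/
theorem tlt_second_const (f : (Fin (3 + 6) → Bool) → Bool)
    (hT : ∀ u v w x : Fin (3 + 6) → Bool,
      (((f x ^^ f (bxor x w)) ^^ (f (bxor x v) ^^ f (bxor (bxor x v) w))) ^^
          ((f (bxor x u) ^^ f (bxor (bxor x u) w)) ^^ (f (bxor (bxor x u) v) ^^ f (bxor (bxor (bxor x u) v) w)))) =
        ((((u (Fin.castAdd 6 0) && (v (Fin.castAdd 6 1) && w (Fin.castAdd 6 2))) ^^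
              (u (Fin.castAdd 6 0) && (v (Fin.castAdd 6 2) && w (Fin.castAdd 6 1)))) ^^
            ((u (Fin.castAdd 6 1) && (v (Fin.castAdd 6 0) && w (Fin.castAdd 6 2))) ^^
              (u (Fin.castAdd 6 1) && (v (Fin.castAdd 6 2) && w (Fin.castAdd 6 0))))) ^^
          ((u (Fin.castAdd 6 2) && (v (Fin.castAdd 6 0) && w (Fin.castAdd 6 1))) ^^
            (u (Fin.castAdd 6 2) && (v (Fin.castAdd 6 1) && w (Fin.castAdd 6 0))))))
    (t : Fin 3 → Bool) (v w x : Fin 6 → Bool) :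
    let Qf : (Fin 3 → Bool) → (Fin 6 → Bool) → Bool := fun t s =>
      f (Fin.append t s) ^^ (((Fin.append t s) (Fin.castAdd 6 0) && (Fin.append t s) (Fin.castAdd 6 1)) && (Fin.append t s) (Fin.castAdd 6 2))
    ((Qf t x ^^ Qf t (bxor x w)) ^^ (Qf t (bxor x v) ^^ Qf t (bxor (bxor x v) w))) =
      ((Qf zeroVec zeroVec ^^ Qf zeroVec w) ^^ (Qf zeroVec v ^^ Qf zeroVec (bxor v w))) := by
  intro Qf
  have e := hT (Fin.append t x) (Fin.append zeroVec v) (Fin.append zeroVec w)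
    (Fin.append (zeroVec : Fin 3 → Bool) (zeroVec : Fin 6 → Bool))
  have hz3 : ∀ k, (zeroVec : Fin 3 → Bool) k = false := fun k => rfl
  simp only [tcc_append_bxor, bxor_zeroVec, zeroVec_bxor, Fin.append_left, hz3, Bool.and_false, Bool.xor_false] at e
  simp only [Qf, Fin.append_left]
  revert e
  generalize f (Fin.append zeroVec zeroVec) = A₁
  generalize f (Fin.append zeroVec w) = A₂
  generalize f (Fin.append zeroVec v) = A₃
  generalize f (Fin.append zeroVec (bxor v w)) = A₄
  generalize f (Fin.append t x) = A₅
  generalize f (Fin.append t (bxor x w)) = A₆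
  generalize f (Fin.append t (bxor x v)) = A₇
  generalize f (Fin.append t (bxor (bxor x v) w)) = A₈
  generalize ((t 0 && t 1) && t 2) = M
  simp only [hz3, Bool.false_and, Bool.xor_false]
  revert A₁ A₂ A₃ A₄ A₅ A₆ A₇ A₈ M
  decide

/-- **Cell lemma L-T (types).**  See the module docstring. [this work; E1280-HANDPROOFS App. A.3] -/
theorem tlt_T_cell_types (f : (Fin (3 + 6) → Bool) → Bool)
    (hT : ∀ u v w x : Fin (3 + 6) → Bool,
      (((f x ^^ f (bxor x w)) ^^ (f (bxor x v) ^^ f (bxor (bxor x v) w))) ^^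
          ((f (bxor x u) ^^ f (bxor (bxor x u) w)) ^^ (f (bxor (bxor x u) v) ^^ f (bxor (bxor (bxor x u) v) w)))) =
        ((((u (Fin.castAdd 6 0) && (v (Fin.castAdd 6 1) && w (Fin.castAdd 6 2))) ^^
              (u (Fin.castAdd 6 0) && (v (Fin.castAdd 6 2) && w (Fin.castAdd 6 1)))) ^^
            ((u (Fin.castAdd 6 1) && (v (Fin.castAdd 6 0) && w (Fin.castAdd 6 2))) ^^
              (u (Fin.castAdd 6 1) && (v (Fin.castAdd 6 2) && w (Fin.castAdd 6 0))))) ^^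
          ((u (Fin.castAdd 6 2) && (v (Fin.castAdd 6 0) && w (Fin.castAdd 6 1))) ^^
            (u (Fin.castAdd 6 2) && (v (Fin.castAdd 6 1) && w (Fin.castAdd 6 0)))))) :
    let Qf : (Fin 3 → Bool) → (Fin 6 → Bool) → Bool := fun t s =>
      f (Fin.append t s) ^^ (((Fin.append t s) (Fin.castAdd 6 0) && (Fin.append t s) (Fin.castAdd 6 1)) && (Fin.append t s) (Fin.castAdd 6 2))
    let B : (Fin 6 → Bool) → (Fin 6 → Bool) → Bool := fun v w =>
      (Qf zeroVec zeroVec ^^ Qf zeroVec w) ^^ (Qf zeroVec v ^^ Qf zeroVec (bxor v w))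
    let βUF : (Fin 3 → Bool) → (Fin 6 → Bool) → Bool := fun a x => (Qf a x ^^ Qf a zeroVec) ^^ (Qf zeroVec x ^^ Qf zeroVec zeroVec)
    64 ≤ #(univ.filter fun y : Fin (3 + 6) → Bool => f y = true) ∧
    (#(univ.filter fun y : Fin (3 + 6) → Bool => f y = true) < 128 → (∀ v w, B v w = false) ∧ ∀ a x, βUF a x = false) ∧
    (#(univ.filter fun y : Fin (3 + 6) → Bool => f y = true) < 160 →
      (∀ v w, B v w = false) ∧ ∃ m : (Fin 6 → Bool) → Bool, ∀ a, (∀ x, βUF a x = false) ∨ (∀ x, βUF a x = m x)) ∧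
    (#(univ.filter fun y : Fin (3 + 6) → Bool => f y = true) < 192 →
      ((∀ v w, B v w = false) ∧ ∃ m : (Fin 6 → Bool) → Bool, ∀ a, (∀ x, βUF a x = false) ∨ (∀ x, βUF a x = m x)) ∨
      (∃ b₀ c₀ : Fin 6 → Bool, B b₀ c₀ = true ∧
        (∀ x y, B x b₀ = false → B x c₀ = false → B y b₀ = false → B y c₀ = false → B x y = false) ∧
        ∀ (t : Fin 3 → Bool) (r : Fin 6 → Bool), (∀ y, B r y = false) → Qf t r = Qf t zeroVec)) := by
  classical
  intro Qf B βUF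
  have hBall : ∀ (t : Fin 3 → Bool) (v w x : Fin 6 → Bool),
      ((Qf t x ^^ Qf t (bxor x w)) ^^ (Qf t (bxor x v) ^^ Qf t (bxor (bxor x v) w))) = B v w :=
    fun t v w x => tlt_second_const f hT t v w x
  obtain ⟨hsymm, -, halt, -⟩ := tcb_form_basic (fun s => Qf zeroVec s) B (hBall zeroVec)
  obtain ⟨h, b, c, hbc, hbc', hbb, -, hmax⟩ := tcs_frame_exists B hsymm halt
  rcases Nat.lt_or_ge h 2 with hlt | hge
  · interval_cases h
    · -- `h = 0`: all fibres affine
      have hFF : ∀ (t : Fin 3 → Bool) (v w x : Fin 6 → Bool),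
          ((Qf t x ^^ Qf t (bxor x w)) ^^ (Qf t (bxor x v) ^^ Qf t (bxor (bxor x v) w))) = false := by
        intro t v w x
        rw [hBall]
        exact hmax v w (fun i => Fin.elim0 i) (fun i => Fin.elim0 i) (fun i => Fin.elim0 i) (fun i => Fin.elim0 i)
      obtain ⟨h128, h192⟩ := tft_T_types_h0 f hT hFF
      have h64 := tft_T_weight_ge f hT hFF
      have hB0 : ∀ v w, B v w = false := fun v w => by rw [← hBall zeroVec v w zeroVec]; exact hFF zeroVec v w zeroVec
      exact ⟨h64, fun hlt => ⟨hB0, h128 hlt⟩, fun h160 => ⟨hB0, h192 (by omega)⟩, fun hlt => Or.inl ⟨hB0, h192 hlt⟩⟩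
    · -- `h = 1`
      obtain ⟨h160, h192⟩ := tfh_T_menu_h1 f hT B hBall 1 b c hbc hbc' hbb hmax rfl
      refine ⟨by omega, fun hlt => absurd hlt (by omega), fun hlt => absurd hlt (by omega),
        fun hlt => Or.inr ⟨b 0, c 0, hbc 0, fun x y h1 h2 h3 h4 => ?_, h192 hlt⟩⟩
      refine hmax x y (fun i => ?_) (fun i => ?_) (fun i => ?_) (fun i => ?_) <;> rw [Subsingleton.elim i 0] <;> assumption
  · -- `h ≥ 2`: weight `≥ 192`
    obtain ⟨h192, -⟩ := tfm_T_menu f hT B hBall h b c hbc hbc' hbb hmax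
    have h192' := h192 hge
    exact ⟨by omega, fun hlt => absurd hlt (by omega), fun hlt => absurd hlt (by omega), fun hlt => absurd hlt (by omega)⟩

end Summit.QuantumAdvantage.QuantumAdvantage.Theorems.CubicForrelation.NearExactIsExact
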